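import Summits.QuantumAdvantage.QuantumAdvantage.Theorems.CharDialTokenDialM1
import Summits.QuantumAdvantage.QuantumAdvantage.Theorems.CharDialTokenDialL
import HarnessLib

/-!
# CharDial tower — the TOKEN DIAL, part M: the LOG-BUDGET flip pieces, their junction with `T` BY NAME, `fieldY` escapes

Cell `decomp-qadv`, lens 6 («barrier-complement carving»), generation 19 (REV3); supports stmt-QuantumAdvantage-27206 / 27207
(crux 32604).  Imports part M1 (`flip_hard_log`) and part L.

(1) the LOG-BUDGET pieces `LowResidualLogSide B` / `ResidualHighLogSide B` / `ResidualLogSide`: the five-dial pieces with the single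
extra escape clause `¬ FlipHyp p (dialB n) (dialB n) y` (no parameter: the budget is the tower's own schedule `dialB n = 4(log₂ n + 1)`);
`flipHyp_mono` (the clause at budget `dialB n` implies every fixed-`(K, w)` clause once `K, w ≤ dialB n`).
(2) the flip dial at log budget absorbed (`flip_hard_log`): `5 ⟺ LOG` on both sides and for the plain residual, every schedule `B`.
(3) ★★ BY NAME: `closes_splitLog`, `T ⟺ LOW-RESIDUAL-LOG ∧ RESIDUAL-HIGH-LOG`, `T ⟺ ResidualLogSide`,
`JLinLowResidual5 (27206) ⟺ LowResidualLogSide dialB`, `JLinResidualHigh5 (27207) ⟺ ResidualHighLogSide dialB`.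
(4) ★★★ `fieldY` escapes the flip dial even at budget `dialB n` (it has `2·dialB n + 1` moving cuts at every adjacency), so
class(RESIDUAL-HIGH-LOG) is INHABITED and the HIGH log piece is tested non-vacuously.  0 sorry.
-/

set_option autoImplicit false

open Finset

namespace Summit.QuantumAdvantage.AdviceFreeQNC0.JLinPeel

namespace TowerDefs

variable {n : ℕ}

/-- **piece RESIDUAL-HIGH-LOG.** `ResidualHigh5Side` with the escape clause `¬ FlipHyp p (dialB n) (dialB n) y`. -/
def ResidualHighLogSide (B : ℕ → ℕ) : Prop :=
  ∀ (p : ℕ) [Fact p.Prime], 5 ≤ p → ∃ θ : ℝ, θ < 1 ∧ ∃ n₀ : ℕ, ∀ n ≥ n₀, ∀ c : ℕ,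
    ∀ y : Fin (n + 1) → (Fin n → Bool) → Bool, JLinHyp p n y → ¬ LowVar B n y → ¬ FlipHyp p (dialB n) (dialB n) y →
      (∀ D : JLinPeel.JLinData p n, D.strat = y → (∀ g, (D.J g).card ≤ Nat.log 2 n) →
          ¬ SpanHyp D ∧ ¬ SparseHyp D ∧ ¬ BlockHyp D ∧ ¬ NullHyp D ∧ ¬ MaskHyp D) →
        ((Finset.univ.filter fun u : Fin n → Bool => ringWinU c y u = true).card : ℝ) ≤ θ * (2 : ℝ) ^ n

/-- **piece LOW-RESIDUAL-LOG.** `LowResidual5Side` with the escape clause `¬ FlipHyp p (dialB n) (dialB n) y`. -/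
def LowResidualLogSide (B : ℕ → ℕ) : Prop :=
  ∀ (p : ℕ) [Fact p.Prime], 5 ≤ p → ∃ θ : ℝ, θ < 1 ∧ ∃ n₀ : ℕ, ∀ n ≥ n₀, ∀ c : ℕ,
    ∀ y : Fin (n + 1) → (Fin n → Bool) → Bool, JLinHyp p n y → LowVar B n y → ¬ FlipHyp p (dialB n) (dialB n) y →
      (∀ D : JLinPeel.JLinData p n, D.strat = y → (∀ g, (D.J g).card ≤ Nat.log 2 n) →
          ¬ SpanHyp D ∧ ¬ SparseHyp D ∧ ¬ BlockHyp D ∧ ¬ NullHyp D ∧ ¬ MaskHyp D) →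
        ((Finset.univ.filter fun u : Fin n → Bool => ringWinU c y u = true).card : ℝ) ≤ θ * (2 : ℝ) ^ n

/-- **the LOG-BUDGET RESIDUAL of T** (no variation condition). -/
def ResidualLogSide : Prop :=
  ∀ (p : ℕ) [Fact p.Prime], 5 ≤ p → ∃ θ : ℝ, θ < 1 ∧ ∃ n₀ : ℕ, ∀ n ≥ n₀, ∀ c : ℕ,
    ∀ y : Fin (n + 1) → (Fin n → Bool) → Bool, JLinHyp p n y → ¬ FlipHyp p (dialB n) (dialB n) y →
      (∀ D : JLinPeel.JLinData p n, D.strat = y → (∀ g, (D.J g).card ≤ Nat.log 2 n) →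
          ¬ SpanHyp D ∧ ¬ SparseHyp D ∧ ¬ BlockHyp D ∧ ¬ NullHyp D ∧ ¬ MaskHyp D) →
        ((Finset.univ.filter fun u : Fin n → Bool => ringWinU c y u = true).card : ℝ) ≤ θ * (2 : ℝ) ^ n

end TowerDefs

namespace TokenDial

open SegMove

variable {n : ℕ}

section LogPieces

variable {p : ℕ} [hp : Fact p.Prime]

omit hp in
/-- the flip hypothesis is monotone in both budgets. -/
theorem flipHyp_mono {K K' w w' : ℕ} (hK : K ≤ K') (hw : w ≤ w') (y : Fin (n + 1) → (Fin n → Bool) → Bool) :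
    TowerDefs.FlipHyp p K w y → TowerDefs.FlipHyp p K' w' y := by
  rintro ⟨s, t, hst, G, hGK, hnear, hS, hrich⟩
  exact ⟨s, t, hst, G, hGK.trans hK, fun g hg => ⟨by have := (hnear g hg).1; omega, by have := (hnear g hg).2; omega⟩,
    hS, hrich⟩

omit hp in
/-- class(LOG) ⊆ class⁵: the five-dial residual gives the log-budget residual. -/
theorem residualLog_of_residual5 : TowerDefs.Residual5Side → TowerDefs.ResidualLogSide := by
  intro h p _ hp5
  obtain ⟨θ, hθ, n₀, hn₀⟩ := h p hp5
  exact ⟨θ, hθ, n₀, fun n hn c y hy _ hesc => hn₀ n hn c y hy hesc⟩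

omit hp in
/-- class(LOG) ⊆ class⁵ on the LOW side. -/
theorem lowResidualLog_of_lowResidual5 (B : ℕ → ℕ) : TowerDefs.LowResidual5Side B → TowerDefs.LowResidualLogSide B := by
  intro h p _ hp5
  obtain ⟨θ, hθ, n₀, hn₀⟩ := h p hp5
  exact ⟨θ, hθ, n₀, fun n hn c y hy hV _ hesc => hn₀ n hn c y hy hV hesc⟩

omit hp in
/-- class(LOG) ⊆ class⁵ on the HIGH side. -/
theorem residualHighLog_of_residualHigh5 (B : ℕ → ℕ) :
    TowerDefs.ResidualHigh5Side B → TowerDefs.ResidualHighLogSide B := by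
  intro h p _ hp5
  obtain ⟨θ, hθ, n₀, hn₀⟩ := h p hp5
  exact ⟨θ, hθ, n₀, fun n hn c y hy hV _ hesc => hn₀ n hn c y hy hV hesc⟩

omit hp in
/-- **absorbing the flip dial at log budget** (the common step): under a side condition `V`, the log-budget piece gives the five-dial
piece, `θ := max θ_log (1 − 1/(48p))`; a strategy meeting `FlipHyp p (dialB n) (dialB n)` is PRESENTED (by choice from `JLinHyp`) and
handed to `flip_hard_log`. -/
theorem absorb_flipLog (V : (p n : ℕ) → (Fin (n + 1) → (Fin n → Bool) → Bool) → Prop)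
    (h9 : ∀ (p : ℕ) [Fact p.Prime], 5 ≤ p → ∃ θ : ℝ, θ < 1 ∧ ∃ n₀ : ℕ, ∀ n ≥ n₀, ∀ c : ℕ,
      ∀ y : Fin (n + 1) → (Fin n → Bool) → Bool, TowerDefs.JLinHyp p n y → V p n y →
        ¬ TowerDefs.FlipHyp p (TowerDefs.dialB n) (TowerDefs.dialB n) y →
        (∀ D : JLinPeel.JLinData p n, D.strat = y → (∀ g, (D.J g).card ≤ Nat.log 2 n) →
            ¬ TowerDefs.SpanHyp D ∧ ¬ TowerDefs.SparseHyp D ∧ ¬ TowerDefs.BlockHyp D ∧ ¬ TowerDefs.NullHyp D ∧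
              ¬ TowerDefs.MaskHyp D) →
          ((Finset.univ.filter fun u : Fin n → Bool => ringWinU c y u = true).card : ℝ) ≤ θ * (2 : ℝ) ^ n) :
    ∀ (p : ℕ) [Fact p.Prime], 5 ≤ p → ∃ θ : ℝ, θ < 1 ∧ ∃ n₀ : ℕ, ∀ n ≥ n₀, ∀ c : ℕ,
      ∀ y : Fin (n + 1) → (Fin n → Bool) → Bool, TowerDefs.JLinHyp p n y → V p n y →
        (∀ D : JLinPeel.JLinData p n, D.strat = y → (∀ g, (D.J g).card ≤ Nat.log 2 n) →
            ¬ TowerDefs.SpanHyp D ∧ ¬ TowerDefs.SparseHyp D ∧ ¬ TowerDefs.BlockHyp D ∧ ¬ TowerDefs.NullHyp D ∧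
              ¬ TowerDefs.MaskHyp D) →
          ((Finset.univ.filter fun u : Fin n → Bool => ringWinU c y u = true).card : ℝ) ≤ θ * (2 : ℝ) ^ n := by
  intro p _ hp5
  have hp3 : p ≠ 3 := by omega
  obtain ⟨θ, hθ, n₉, hn₉⟩ := h9 p hp5
  obtain ⟨n₁, hn₁⟩ := flip_hard_log (p := p) hp3
  have hpR : (0 : ℝ) < p := by exact_mod_cast (show 0 < p by omega)
  have hθ' : (1 : ℝ) - 1 / (48 * p) < 1 := by
    have : (0 : ℝ) < 1 / (48 * p) := by positivity
    linarith
  refine ⟨max θ (1 - 1 / (48 * p)), max_lt hθ hθ', max n₉ n₁, fun n hn c y hy hV hesc => ?_⟩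
  have h2n : (0 : ℝ) ≤ (2 : ℝ) ^ n := by positivity
  by_cases hfl : TowerDefs.FlipHyp p (TowerDefs.dialB n) (TowerDefs.dialB n) y
  · have hy' := hy
    unfold TowerDefs.JLinHyp at hy'
    choose J hJ a h hdep hrep using hy'
    let D : JLinPeel.JLinData p n := ⟨J, a, h, fun g u v huv s => hdep g u v huv s⟩
    have hD : D.strat = y := by
      funext g u
      exact (hrep g u).symm
    have hfl' : TowerDefs.FlipHyp p (TowerDefs.dialB n) (TowerDefs.dialB n) D.strat := by rw [hD]; exact hfl
    have h := hn₁ n (le_trans (le_max_right _ _) hn) c D hJ hfl'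
    rw [hD] at h
    exact h.trans (mul_le_mul_of_nonneg_right (le_max_right _ _) h2n)
  · have h := hn₉ n (le_trans (le_max_left _ _) hn) c y hy hV hfl hesc
    exact h.trans (mul_le_mul_of_nonneg_right (le_max_left _ _) h2n)

omit hp in
/-- ★ the log-budget residual gives the five-dial residual (flip dial at log budget absorbed). -/
theorem residual5_of_residualLog : TowerDefs.ResidualLogSide → TowerDefs.Residual5Side := by
  intro h9
  have h := absorb_flipLog (fun _ _ _ => True) (fun p _ hp5 => by
    obtain ⟨θ, hθ, n₀, hn₀⟩ := h9 p hp5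
    exact ⟨θ, hθ, n₀, fun n hn c y hy _ hF hesc => hn₀ n hn c y hy hF hesc⟩)
  intro p _ hp5
  obtain ⟨θ, hθ, n₀, hn₀⟩ := h p hp5
  exact ⟨θ, hθ, n₀, fun n hn c y hy hesc => hn₀ n hn c y hy trivial hesc⟩

omit hp in
/-- ★ LOW-RESIDUAL-LOG gives LOW-RESIDUAL⁵, every schedule `B`. -/
theorem lowResidual5_of_lowResidualLog (B : ℕ → ℕ) : TowerDefs.LowResidualLogSide B → TowerDefs.LowResidual5Side B :=
  fun h9 => absorb_flipLog (fun _ n y => TowerDefs.LowVar B n y) h9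

omit hp in
/-- ★ RESIDUAL-HIGH-LOG gives RESIDUAL-HIGH⁵, every schedule `B`. -/
theorem residualHigh5_of_residualHighLog (B : ℕ → ℕ) :
    TowerDefs.ResidualHighLogSide B → TowerDefs.ResidualHigh5Side B :=
  fun h9 => absorb_flipLog (fun _ n y => ¬ TowerDefs.LowVar B n y) h9

omit hp in
/-- ★★ RESIDUAL⁵ ⟺ RESIDUAL-LOG. -/
theorem residual5_iff_residualLog : TowerDefs.Residual5Side ↔ TowerDefs.ResidualLogSide :=
  ⟨residualLog_of_residual5, residual5_of_residualLog⟩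

omit hp in
/-- ★★ LOW-RESIDUAL⁵ ⟺ LOW-RESIDUAL-LOG, every schedule `B`. -/
theorem lowResidual5_iff_lowResidualLog (B : ℕ → ℕ) : TowerDefs.LowResidual5Side B ↔ TowerDefs.LowResidualLogSide B :=
  ⟨lowResidualLog_of_lowResidual5 B, lowResidual5_of_lowResidualLog B⟩

omit hp in
/-- ★★ RESIDUAL-HIGH⁵ ⟺ RESIDUAL-HIGH-LOG, every schedule `B`. -/
theorem residualHigh5_iff_residualHighLog (B : ℕ → ℕ) :
    TowerDefs.ResidualHigh5Side B ↔ TowerDefs.ResidualHighLogSide B :=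
  ⟨residualHighLog_of_residualHigh5 B, residualHigh5_of_residualHighLog B⟩

omit hp in
/-- ★ RESIDUAL⁹(K, w) ⟺ RESIDUAL-LOG, every `K`, `w` (both are ⟺ RESIDUAL⁵). -/
theorem residual9_iff_residualLog (K w : ℕ) : TowerDefs.Residual9Side K w ↔ TowerDefs.ResidualLogSide :=
  (residual5_iff_residual9 K w).symm.trans residual5_iff_residualLog

end LogPieces

/-! ### (3) the log-budget split of T, by name -/

/-- ★★ **the DECIDING THEOREM of the log-budget split** (item vocabulary): LOW-RESIDUAL-LOG ∧ RESIDUAL-HIGH-LOG at schedule `dialB`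
close `T`. -/
theorem closes_splitLog (hL : TowerDefs.LowResidualLogSide TowerDefs.dialB) (hH : TowerDefs.ResidualHighLogSide TowerDefs.dialB) :
    Summit.QuantumAdvantage.QuantumAdvantage.Theses.CharDial.WalkHardFJLinOdd :=
  closes_split6 ((lowResidual5_iff_lowResidual6 TowerDefs.dialB).1 (lowResidual5_of_lowResidualLog TowerDefs.dialB hL))
    ((residualHigh5_iff_residualHigh6 TowerDefs.dialB).1 (residualHigh5_of_residualHighLog TowerDefs.dialB hH))

/-- ★★ conversely `T` gives both log-budget pieces. -/
theorem splitLog_of_closes (hT : Summit.QuantumAdvantage.QuantumAdvantage.Theses.CharDial.WalkHardFJLinOdd) :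
    TowerDefs.LowResidualLogSide TowerDefs.dialB ∧ TowerDefs.ResidualHighLogSide TowerDefs.dialB :=
  let ⟨hL, hH⟩ := split6_of_closes hT
  ⟨lowResidualLog_of_lowResidual5 _ ((lowResidual5_iff_lowResidual6 TowerDefs.dialB).2 hL),
    residualHighLog_of_residualHigh5 _ ((residualHigh5_iff_residualHigh6 TowerDefs.dialB).2 hH)⟩

/-- ★★ `T ⟺ LOW-RESIDUAL-LOG(dialB) ∧ RESIDUAL-HIGH-LOG(dialB)`. -/
theorem walkHardFJLinOdd_iff_residualLog_split :
    Summit.QuantumAdvantage.QuantumAdvantage.Theses.CharDial.WalkHardFJLinOdd ↔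
      (TowerDefs.LowResidualLogSide TowerDefs.dialB ∧ TowerDefs.ResidualHighLogSide TowerDefs.dialB) :=
  ⟨splitLog_of_closes, fun h => closes_splitLog h.1 h.2⟩

/-- ★★ `T ⟺ RESIDUAL-LOG` (the flip dial at budget `dialB n` absorbed, no variation split). -/
theorem walkHardFJLinOdd_iff_residualLog :
    Summit.QuantumAdvantage.QuantumAdvantage.Theses.CharDial.WalkHardFJLinOdd ↔ TowerDefs.ResidualLogSide :=
  walkHardFJLinOdd_iff_residual6.trans (residual5_iff_residual6.symm.trans residual5_iff_residualLog)

/-- ★ the filed LOW piece (item 27206) ⟺ LOW-RESIDUAL-LOG(dialB), by name. -/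
theorem jlinLowResidual5_iff_lowResidualLog :
    Summit.QuantumAdvantage.QuantumAdvantage.Theses.CharDial.JLinLowResidual5 ↔
      TowerDefs.LowResidualLogSide TowerDefs.dialB :=
  jlinLowResidual5_iff_lowResidual6.trans
    ((lowResidual5_iff_lowResidual6 TowerDefs.dialB).symm.trans (lowResidual5_iff_lowResidualLog TowerDefs.dialB))

/-- ★ the filed HIGH residual (item 27207) ⟺ RESIDUAL-HIGH-LOG(dialB), by name. -/
theorem jlinResidualHigh5_iff_residualHighLog :
    Summit.QuantumAdvantage.QuantumAdvantage.Theses.CharDial.JLinResidualHigh5 ↔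
      TowerDefs.ResidualHighLogSide TowerDefs.dialB :=
  jlinResidualHigh5_iff_residualHigh6.trans
    ((residualHigh5_iff_residualHigh6 TowerDefs.dialB).symm.trans (residualHigh5_iff_residualHighLog TowerDefs.dialB))

/-! ### (4) the RESIDUAL-HIGH-LOG class is inhabited: `fieldY` has more than `dialB n` moving cuts at every adjacency -/

section EscapeLog

variable {p : ℕ} [hp : Fact p.Prime]

/-- ★★★ **`fieldY` in class(RESIDUAL-HIGH-LOG), eventually** (every prime `p ≥ 5`): JLin-presentable, HIGH at `dialB`, outside the flip
dial even at budget `K = w = dialB n` (it has `2·dialB n + 1 > dialB n` full-pattern cuts per column, all moving at every adjacency),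
and in EVERY `log₂ n`-junta presentation outside the rank, sparse, block, null and mask dials. -/
theorem fieldY_classLog_eventually (hp5 : 5 ≤ p) : ∃ n₀ : ℕ, ∀ n ≥ n₀, ∃ α : GaloisField p (FieldCol.rk n),
    TowerDefs.JLinHyp p n (FieldCol.fieldY p n α) ∧ ¬ TowerDefs.LowVar TowerDefs.dialB n (FieldCol.fieldY p n α) ∧
    ¬ TowerDefs.FlipHyp p (TowerDefs.dialB n) (TowerDefs.dialB n) (FieldCol.fieldY p n α) ∧
    ∀ D : JLinPeel.JLinData p n, D.strat = FieldCol.fieldY p n α → (∀ g, (D.J g).card ≤ Nat.log 2 n) →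
      ¬ TowerDefs.SpanHyp D ∧ ¬ TowerDefs.SparseHyp D ∧ ¬ TowerDefs.BlockHyp D ∧ ¬ TowerDefs.NullHyp D ∧
        ¬ TowerDefs.MaskHyp D := by
  have hp3 : p % 3 = 1 ∨ p % 3 = 2 := Tower.mod3_of_prime_ge5 hp.out hp5
  obtain ⟨n₁, hn₁⟩ := FieldCol.eventually_fits p
  obtain ⟨n₂, hn₂⟩ := FieldCol.eventually_big p
  obtain ⟨n₃, hn₃⟩ := FieldCol.eventually_misc p
  obtain ⟨n₄, hn₄⟩ := FieldCol.field_not_span_eventually p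
  refine ⟨max (max n₁ n₂) (max n₃ n₄), fun n hn => ?_⟩
  have hfit := hn₁ n (le_trans (le_trans (le_max_left _ _) (le_max_left _ _)) hn)
  have hbig := hn₂ n (le_trans (le_trans (le_max_right _ _) (le_max_left _ _)) hn)
  obtain ⟨hpL, hpn, hn9⟩ := hn₃ n (le_trans (le_trans (le_max_left _ _) (le_max_right _ _)) hn)
  have hspan := hn₄ n (le_trans (le_trans (le_max_right _ _) (le_max_right _ _)) hn)
  obtain ⟨α, hα⟩ := FieldCol.exists_generic p n (by omega)
  have h0 : α ≠ 0 := FieldCol.generic_ne_zero p n (by omega) α hα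
  have h1 : α ≠ 1 := FieldCol.generic_ne_one p n hpL hpn α hα
  have hL2 : 2 ≤ Nat.log 2 n := le_trans (by omega) hpL
  have hK : TowerDefs.dialB n + 1 ≤ 2 * (4 * (Nat.log 2 n + 1)) + 1 := by unfold TowerDefs.dialB; omega
  refine ⟨α, ?_, FieldCol.not_low_fieldY p n _ hbig le_rfl (by omega) α h0 h1,
    field_not_flip n (TowerDefs.dialB n) (TowerDefs.dialB n) _ hbig hK α h0 h1, fun D hD hJ => ?_⟩
  · intro g
    exact ⟨∅, by simp, (FieldCol.fieldData p n α).a g, (FieldCol.fieldData p n α).h g, fun _ _ _ _ => rfl, fun u => rfl⟩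
  · have hM : ¬ TowerDefs.MaskHyp D := (Tower.maskHyp_iff_inlined D).not.mpr (FieldCol.field_not_mask p n hfit α hα D hD hJ)
    exact ⟨(Tower.spanHyp_iff_inlined D).not.mpr (hspan α D hD hJ),
      (Tower.sparseHyp_iff_inlined D).not.mpr (FieldCol.field_not_sparse p n hfit hL2 α D hD),
      fun hB => hM (Tower.maskHyp_of_blockHyp hp3 D hB), fun hN => hM (Tower.maskHyp_of_nullHyp D hN), hM⟩

/-- ★★★ **class(RESIDUAL-HIGH-LOG) IS INHABITED** (item vocabulary): for every prime `p ≥ 5` and all large `n` some strategy satisfies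
the JLin hypothesis, is HIGH at `dialB`, escapes the flip dial at budget `dialB n`, and escapes the five decided presentation-level dials in
every `log₂ n`-junta ⊕ one-form presentation. -/
theorem residualHighLog_class_inhabited (p : ℕ) [Fact p.Prime] (hp5 : 5 ≤ p) :
    ∃ n₁ : ℕ, ∀ n ≥ n₁, ∃ y : Fin (n + 1) → (Fin n → Bool) → Bool,
      TowerDefs.JLinHyp p n y ∧ ¬ TowerDefs.LowVar TowerDefs.dialB n y ∧
      ¬ TowerDefs.FlipHyp p (TowerDefs.dialB n) (TowerDefs.dialB n) y ∧
      ∀ D : JLinPeel.JLinData p n, D.strat = y → (∀ g, (D.J g).card ≤ Nat.log 2 n) →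
        ¬ TowerDefs.SpanHyp D ∧ ¬ TowerDefs.SparseHyp D ∧ ¬ TowerDefs.BlockHyp D ∧ ¬ TowerDefs.NullHyp D ∧
          ¬ TowerDefs.MaskHyp D := by
  obtain ⟨n₀, h⟩ := fieldY_classLog_eventually (p := p) hp5
  exact ⟨n₀, fun n hn => let ⟨α, hy, hV, hF, hesc⟩ := h n hn; ⟨FieldCol.fieldY p n α, hy, hV, hF, hesc⟩⟩

/-- ★ **RESIDUAL-HIGH-LOG is tested NON-VACUOUSLY**: a purported `ResidualHighLogSide dialB` bound applies to an actual member of its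
class. -/
theorem residualHighLog_nonvacuous (hR : TowerDefs.ResidualHighLogSide TowerDefs.dialB) (p : ℕ) [Fact p.Prime] (hp5 : 5 ≤ p) :
    ∃ θ : ℝ, θ < 1 ∧ ∃ n₀ : ℕ, ∀ n ≥ n₀, ∃ y : Fin (n + 1) → (Fin n → Bool) → Bool,
      TowerDefs.JLinHyp p n y ∧ ¬ TowerDefs.LowVar TowerDefs.dialB n y ∧ ∀ c : ℕ,
        ((Finset.univ.filter fun u : Fin n → Bool => ringWinU c y u = true).card : ℝ) ≤ θ * (2 : ℝ) ^ n := by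
  obtain ⟨θ, hθ, n₀, h⟩ := hR p hp5
  obtain ⟨n₁, h₁⟩ := residualHighLog_class_inhabited p hp5
  refine ⟨θ, hθ, max n₀ n₁, fun n hn => ?_⟩
  obtain ⟨y, hy, hV, hF, hesc⟩ := h₁ n (le_trans (le_max_right _ _) hn)
  exact ⟨y, hy, hV, fun c => h n (le_trans (le_max_left _ _) hn) c y hy hV hF hesc⟩

end EscapeLog

end TokenDial

end Summit.QuantumAdvantage.AdviceFreeQNC0.JLinPeel
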